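import Literature.Computability.QuantumComplexity.OracleWalkMachine
import Literature.Computability.QuantumComplexity.GuessedOracleRuns
import Literature.Computability.Complexity.ListBricks
import HarnessLib

/-!
# The guessed walk of an oracle Clifford+`T` circuit as `FP` string functions: one round, `t` rounds, all rounds

Machine-level file for the polynomial-time half of Aaronson–Ambainis' Thm. 23 (arXiv:0911.0996v3,
p. 14: "we can implement `C` using … `poly(n)` computation steps"): the guessed total walk
`ADH.tRunO` of `GuessedOracleRuns.lean` (one coin per gate; at an oracle gate the coin is the
guessed answer bit, XORed into the answer wire) realised in the brick algebra, continuing the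
Adleman–DeMarrais–Huang machine of `ADHMachine.lean` (and reusing the gate-code lemmas `encode_oracle`,
`tagT` of `OracleWalkMachine.lean`, the two-coins-per-gate relativized walk of the `accGap` machine) (records `rec6 d E co w ph v`, the round
`roundF` for gate symbols with `roundF_rec`, growth `30`, first field kept):

* `oR`, **`roundO`** — the round extended to oracle gates (dispatch on the tag bit of the next
  gate code; the target wire `e k` is item `k` of the wire list, `Brick.nthLF`), `roundO_mem_FP`,
  `roundO_rec` (**one round is one step of `tStepO`**, every gate), `length_roundO_le` (growth
  `≤ 30`), `fstF_roundO`;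
* `iterate_roundO` (enough rounds walk the whole list: `tRunO`), `iterate_roundO_prefix` (`t ≤ μ`
  rounds walk the first `t` gates and leave the codes of the rest ahead);
* `passO` (`|d|` rounds, in `FP`), and the counted walk **`walkO`** on `⟨x, ⟨co, bin t⟩⟩`
  (`Brick.loopX` with the round as body): `walkO_mem_FP`, **`walkO_apply`** — after `t ≤ μ` rounds
  the record holds the codes of the gates `t, t+1, …`, the unread coins `co ⇂ t`, and the state
  `tRunO (gates ↾ t) co (x0^m, 0, valid)`; and `finalO` on `⟨x, co⟩` (`finalO_apply`: the state
  `tRunO gates co (x0^m, 0, valid)`).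

These are the atoms (label, next gate code, coin at round `t`; endpoint, phase, flag) from which
the counting-hierarchy formulas of the sequel are assembled. No named facts.

## References

* S. Aaronson, A. Ambainis, *The need for structure in quantum speedups*, Theory Comput. 10
  (2014), proof of Thm. 23 (arXiv:0911.0996v3, p. 14) [AaronsonAmbainis2014].
* L. M. Adleman, J. DeMarrais, M.-D. A. Huang, *Quantum computability*, SIAM J. Comput. 26 (1997),
  §6, Lemma 6.10 (proof, step 3: walking a guessed path) [AdlemanDeMarraisHuang1997].
* S. Arora, B. Barak, *Computational Complexity: A Modern Approach*, CUP 2009, §1.3 (composition,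
  bounded loops), §6.2 (descriptions of uniform families).
-/

noncomputable section

namespace Literature.Computability.QuantumComplexity

namespace ADH

open _root_.Computability Polynomial Complexity Complexity.Brick Complexity.Plumb Cryptography

attribute [-simp] Brick.nthF_zero Brick.sndPow_zero

variable {N : ℕ}

/-! ### The oracle round -/

/-- The binary code of the target wire of an oracle gate: item `k` of the wire list
`⟨bin e₀, …, ⟨bin e_k, ε⟩⟩` (`k = val opF`; the label serves as yardstick, `k < |w|`). [folklore] -/
def tgF : List Bool → List Bool := nthLF ∘ pr wF (pr opF wsF)
/-- The target wire in unary, capped by the label length. [folklore] -/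
def utgF : List Bool → List Bool := binToUnaryFn ∘ pr wF tgF
/-- The label bit on the target wire. [folklore] -/
def wtgT : List Bool → List Bool := bitT (bitAtFn ∘ pr utgF wF)
/-- The record after an oracle gate: the coin (guessed answer) XORed into the target wire, phase
and flag kept. [cite: AaronsonAmbainis2014, proof of Thm. 23 (p. 14)] -/
def oR : List Bool → List Bool := mk6 dF e'F co'F (setF utgF (xorT wtgT cT)) (addPh 0) vT

/-- **One round of the guessed walk**: oracle round on an oracle code, else `roundF`. [cite: AaronsonAmbainis2014, proof of Thm. 23 (p. 14)] -/
def roundO : List Bool → List Bool := iteFn tagT oR roundF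

/-- `tgF ∈ FP`. [folklore] -/
theorem tgF_mem_FP : tgF ∈ FP :=
  comp_mem_FP nthLF_mem_FP (fanoutFn_mem_FP (nthF_mem_FP 3) (fanoutFn_mem_FP opF_mem_FP wsF_mem_FP))
/-- `utgF ∈ FP`. [folklore] -/
theorem utgF_mem_FP : utgF ∈ FP := comp_mem_FP binToUnaryFn_mem_FP (fanoutFn_mem_FP (nthF_mem_FP 3) tgF_mem_FP)
/-- `wtgT ∈ FP`. [folklore] -/
theorem wtgT_mem_FP : wtgT ∈ FP := bitT_mem_FP (comp_mem_FP bitAtFn_mem_FP (fanoutFn_mem_FP utgF_mem_FP (nthF_mem_FP 3)))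
/-- `oR ∈ FP`. [folklore] -/
theorem oR_mem_FP : oR ∈ FP :=
  mk6_mem_FP (nthF_mem_FP 0) e'F_mem_FP co'F_mem_FP (setF_mem_FP utgF_mem_FP (xorT_mem_FP wtgT_mem_FP cT_mem_FP))
    (addPh_mem_FP 0) vT_mem_FP
/-- **`roundO ∈ FP`.** [cite: AroraBarak2009, §1.3] -/
theorem roundO_mem_FP : roundO ∈ FP := iteFn_mem_FP tagT_mem_FP oR_mem_FP roundF_mem_FP

/-- Value of `wtgT`. [folklore] -/
theorem wtgT_apply (z : List Bool) : wtgT z = [headBit (bitAtFn (boolPair (utgF z) (wF z)))] := by simp [wtgT]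

/-- `roundO` as a case distinction on the tag bit. [folklore] -/
theorem roundO_eq (z : List Bool) : roundO z = if headBit (gF z) = true then oR z else roundF z := by
  rw [roundO, iteFn_apply (show tagT z = [headBit (gF z)] by simp [tagT])]

/-- Growth of the oracle round: `≤ 30`. [folklore] -/
theorem length_oR_le (z : List Bool) : (oR z).length ≤ z.length + roundGrowth := by
  have hf := length_fields_le z
  have h1 := length_setF_le utgF (xorT wtgT cT) z (by
    rw [xorT_apply (wtgT_apply z) (show cT z = [headBit (coF z)] by simp [cT])]; simp)
  have h2 := length_addPh_le 0 z
  have h3 : (vT z).length = 1 := by rw [vT_apply]; simp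
  have he : (e'F z).length ≤ (eF z).length := by
    have := length_fstF_sndF_le (eF z); simp only [e'F, Function.comp_apply]; omega
  have hc : (co'F z).length ≤ (coF z).length := by simp [co'F]
  rw [oR, mk6_apply, length_rec6]
  simp only [roundGrowth]
  omega

/-- **Constant growth**: `|roundO z| ≤ |z| + 30`. [folklore] -/
theorem length_roundO_le (z : List Bool) : (roundO z).length ≤ z.length + roundGrowth := by
  rw [roundO_eq]; split_ifs; exacts [length_oR_le z, length_roundF_le z]

/-- **The first field is kept.** [folklore] -/
theorem fstF_roundO (z : List Bool) : fstF (roundO z) = fstF z := by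
  rw [roundO_eq]; split_ifs
  · simp [oR, Brick.nthF_zero]
  · exact fstF_roundF z

/-! ### One round on a record -/

section RoundSpec

variable (d : List Bool) (l : List (List Bool)) (co : List Bool) (w : QReg N) (ph v : List Bool)

/-- The tag bit read off a record whose next code starts with `b`. [folklore] -/
theorem headBit_gF_rec6 (b : Bool) (rest : List Bool) (E' cw wl : List Bool) :
    headBit (gF (rec6 d (boolPair (b :: rest) E') cw wl ph v)) = b := by
  simp [gF, nthF]

/-- The round on a record whose next gate code is an oracle code `1 ⟨bin k, ⟨ar, wires of e⟩⟩`: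
the parsed pieces. [folklore] -/
theorem piecesO_rec6 (k : ℕ) (e : Fin (k + 1) ↪ Fin N) (ar : List Bool) (φ : ℕ) (vb : Bool) :
    let z := rec6 d (encList ((true :: boolPair (encodeNat k) (boolPair ar
      (encList (List.ofFn fun i : Fin (k + 1) => encodeNat ((e i : Fin N) : ℕ))))) :: l)) co (List.ofFn w) (ones φ) [vb]
    headBit (gF z) = true ∧ e'F z = encList l ∧ co'F z = co.tail ∧ cT z = [headBit co] ∧
      utgF z = ones (e (Fin.last k)) ∧ wtgT z = [w (e (Fin.last k))] ∧
      dF z = d ∧ wF z = List.ofFn w ∧ phF z = ones φ ∧ vF z = [vb] := by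
  intro z
  have hE : eF z = boolPair (true :: boolPair (encodeNat k) (boolPair ar
      (encList (List.ofFn fun i : Fin (k + 1) => encodeNat ((e i : Fin N) : ℕ))))) (encList l) := by
    simp [z, nthF, encList_cons]
  have hco : coF z = co := by simp [z, nthF]
  have hw : wF z = List.ofFn w := by simp [z, nthF]
  have hop : opF z = encodeNat k := by simp [opF, gtF, gF, hE]
  have hws : wsF z = encList (List.ofFn fun i : Fin (k + 1) => encodeNat ((e i : Fin N) : ℕ)) := by
    simp [wsF, gtF, gF, hE]
  have hk : k + 1 ≤ N := by simpa using Fintype.card_le_of_embedding e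
  have htg : tgF z = encodeNat (e (Fin.last k)) := by
    simp only [tgF, Function.comp_apply, fanoutFn_apply, hw, hop, hws]
    rw [nthLF_apply _ (by simp; omega), List.getD_eq_getElem _ _ (by simp), List.getElem_ofFn]
    rfl
  have hut : utgF z = ones (e (Fin.last k)) := by
    simp only [utgF, Function.comp_apply, fanoutFn_apply, hw, htg]
    exact binToUnaryFn_label w _
  refine ⟨by simp [gF, hE], by simp [e'F, hE], by simp [co'F, hco], by simp [cT, hco], hut, ?_,
    by simp [z, Brick.nthF_zero], hw, by simp [z, nthF], by simp [z, sndPow]⟩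
  rw [wtgT_apply, hut, hw, bitAtFn_label]
  simp [headBit]

/-- **One round on an oracle gate.** [cite: AaronsonAmbainis2014, proof of Thm. 23 (p. 14)] -/
theorem roundO_rec_oracle (k : ℕ) (e : Fin (k + 1) ↪ Fin N) (φ : ℕ) (vb : Bool) :
    roundO (rec6 d (encList ((QGate.oracle k e : QGate cliffordT N).encode :: l)) co (List.ofFn w) (ones φ) [vb]) =
      rec6 d (encList l) co.tail
        (List.ofFn (Function.update w (e (Fin.last k)) (w (e (Fin.last k)) ^^ headBit co))) (ones (φ % 8)) [vb] := by
  rw [encode_oracle]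
  obtain ⟨htag, he', hco', hcT, hut, hwt, hd, hw, hph, hv⟩ := piecesO_rec6 d l co w k e (ones (k + 1)) φ vb
  set z := rec6 d (encList ((true :: boolPair (encodeNat k) (boolPair (ones (k + 1))
      (encList (List.ofFn fun i : Fin (k + 1) => encodeNat ((e i : Fin N) : ℕ))))) :: l)) co (List.ofFn w) (ones φ) [vb]
    with hz
  have h1 : setF utgF (xorT wtgT cT) z = List.ofFn (Function.update w (e (Fin.last k)) (w (e (Fin.last k)) ^^ headBit co)) := by
    rw [setF_apply, hut, xorT_apply hwt hcT, hw]
    simpa using set_label w (e (Fin.last k)) (w (e (Fin.last k)) ^^ headBit co)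
  have h2 : addPh 0 z = ones (φ % 8) := by rw [addPh_apply, hph, length_ones, Nat.add_zero]
  have h3 : vT z = [vb] := by rw [vT_apply, hv]; cases vb <;> simp
  rw [roundO_eq, if_pos htag, oR, mk6_apply, hd, he', hco', h1, h2, h3]

/-- **One round is one guessed step.** On the record of a walk whose next gate is `g` (any gate,
oracle gates included), `roundO` computes `ADH.tStepO g` on the coin read off the coins. [cite: AaronsonAmbainis2014, proof of Thm. 23 (p. 14)] [cite: AdlemanDeMarraisHuang1997, §6 Lemma 6.10 (proof, step 3)] -/
theorem roundO_rec (g : QGate cliffordT N) (φ : ℕ) (vb : Bool) :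
    roundO (rec6 d (encList (g.encode :: l)) co (List.ofFn w) (ones φ) [vb]) =
      rec6 d (encList l) co.tail (List.ofFn (tStepO g (headBit co) (w, φ, vb)).1)
        (ones (tStepO g (headBit co) (w, φ, vb)).2.1) [(tStepO g (headBit co) (w, φ, vb)).2.2] := by
  cases g with
  | oracle k e => exact roundO_rec_oracle d l co w k e φ vb
  | gate op e =>
    have htag : headBit (gF (rec6 d (encList ((QGate.gate op e : QGate cliffordT N).encode :: l)) co (List.ofFn w)
        (ones φ) [vb])) = false := by
      rw [encList_cons]
      cases op <;> simp [gF, nthF, QGate.encode]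
    rw [roundO_eq, if_neg (by rw [htag]; decide)]
    exact roundF_rec d l co w (.gate op e) trivial φ vb

end RoundSpec

/-! ### Walks on a record -/

/-- A record with no gate ahead is fixed by the round. [folklore] -/
theorem roundO_idle (d co wl ph v : List Bool) : roundO (rec6 d [] co wl ph v) = rec6 d [] co wl ph v := by
  have htag : headBit (gF (rec6 d [] co wl ph v)) = false := by simp [gF, nthF]
  rw [roundO_eq, if_neg (by rw [htag]; decide)]
  exact roundF_idle d co wl ph v

/-- **Enough rounds walk the whole gate list** (`ADH.tRunO`), consuming one coin per gate, and then
idle. [cite: AaronsonAmbainis2014, proof of Thm. 23 (p. 14)] [cite: AdlemanDeMarraisHuang1997, §6 Lemma 6.10 (proof, step 3)] -/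
theorem iterate_roundO (d : List Bool) (gs : List (QGate cliffordT N)) :
    ∀ (n : ℕ) (co : List Bool) (s : TState N), gs.length ≤ n →
    roundO^[n] (rec6 d (encList (gs.map QGate.encode)) co (List.ofFn s.1) (ones s.2.1) [s.2.2]) =
      rec6 d [] (co.drop gs.length) (List.ofFn (tRunO gs co s).1) (ones (tRunO gs co s).2.1) [(tRunO gs co s).2.2] := by
  induction gs with
  | nil =>
    intro n co s _
    simp only [List.map_nil, encList_nil, List.length_nil, List.drop_zero, tRunO]
    exact Function.iterate_fixed (roundO_idle d co _ _ _) n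
  | cons g gs ih =>
    intro n co s hn
    rw [List.length_cons] at hn
    obtain ⟨n, rfl⟩ : ∃ n', n = n' + 1 := Nat.exists_eq_add_one.2 (by omega)
    obtain ⟨w, φ, vb⟩ := s
    rw [Function.iterate_succ_apply, List.map_cons, roundO_rec d (gs.map QGate.encode) co w g φ vb,
      ih n co.tail _ (by omega)]
    simp [tRunO, List.drop_tail]

/-- **A prefix of the walk**: `t ≤ μ` rounds walk the first `t` gates and leave the codes of the
remaining gates ahead. [folklore] -/
theorem iterate_roundO_prefix (d : List Bool) :
    ∀ (t : ℕ) (gs : List (QGate cliffordT N)) (co : List Bool) (s : TState N), t ≤ gs.length →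
    roundO^[t] (rec6 d (encList (gs.map QGate.encode)) co (List.ofFn s.1) (ones s.2.1) [s.2.2]) =
      rec6 d (encList ((gs.drop t).map QGate.encode)) (co.drop t) (List.ofFn (tRunO (gs.take t) co s).1)
        (ones (tRunO (gs.take t) co s).2.1) [(tRunO (gs.take t) co s).2.2]
  | 0, gs, co, s, _ => by simp [tRunO]
  | t + 1, [], co, s, h => by simp at h
  | t + 1, g :: gs, co, s, h => by
    obtain ⟨w, φ, vb⟩ := s
    rw [Function.iterate_succ_apply, List.map_cons, roundO_rec d (gs.map QGate.encode) co w g φ vb,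
      iterate_roundO_prefix d t gs co.tail _ (by simpa using h)]
    simp [tRunO, List.drop_tail]

/-! ### The walks as `FP` string functions -/

section Walks

variable (F : QCircuitFamily cliffordT)

/-- **All rounds**: `|d|` rounds of `roundO`. [cite: AroraBarak2009, §1.4.1 (clocked loops)] -/
def passO : List Bool → List Bool := fun r => roundO^[(X : Polynomial ℕ).eval (fstF r).length] r

/-- `passO ∈ FP`. [cite: AroraBarak2009, §1.3, §1.4.1] -/
theorem passO_mem_FP : passO ∈ FP :=
  iterate_mem_FP_of_growth roundO_mem_FP roundGrowth fstF_roundO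
    (fun w => (length_roundO_le w).trans (by nlinarith [Nat.zero_le (boolUnpair w).1.length])) X

/-- `passO` on a record: `|d|` rounds. [folklore] -/
theorem passO_rec6 (d E co wl ph v : List Bool) : passO (rec6 d E co wl ph v) = roundO^[d.length] (rec6 d E co wl ph v) := by
  simp [passO, fstF]

/-- **The final record** of the guessed walk on `⟨x, co⟩`. [cite: AaronsonAmbainis2014, proof of Thm. 23 (p. 14)] -/
def finalO : List Bool → List Bool := passO ∘ rec1F F

/-- `finalO ∈ FP` for a uniform family. [cite: AroraBarak2009, §1.3, §6.2] -/
theorem finalO_mem_FP (hU : F.IsUniform) : finalO F ∈ FP := comp_mem_FP passO_mem_FP (rec1F_mem_FP F hU)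

/-- **The final record holds the guessed state** `tRunO gates co (x0^m, 0, valid)`. [cite: AaronsonAmbainis2014, proof of Thm. 23 (p. 14)] -/
theorem finalO_apply (x co : List Bool) :
    finalO F (boolPair x co) =
      (let gs := (F.circ x.length).gates
       let r := tRunO gs co (w₀ F x, 0, true)
       rec6 (F.descFn x) [] (co.drop gs.length) (List.ofFn r.1) (ones r.2.1) [r.2.2]) := by
  simp only [finalO, Function.comp_apply, rec1F_boolPair, passO_rec6]
  exact iterate_roundO (F.descFn x) _ _ co (w₀ F x, 0, true) (length_gates_le_length_descFn F x)

/-- The loop record `⟨d, ⟨bin t, first walk record⟩⟩` from `⟨x, ⟨co, bin t⟩⟩`. [folklore] -/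
def walkInitF : List Bool → List Bool :=
  pr (F.descFn ∘ fstF) (pr (sndF ∘ sndF)
    (mk6 (F.descFn ∘ fstF) (sndF ∘ sndF ∘ F.descFn ∘ fstF) (fstF ∘ sndF)
      (OracleCompose.concatFn ∘ pr fstF (Kannan.zerosFn ∘ fstF ∘ sndF ∘ F.descFn ∘ fstF))
      (fun _ => []) (fun _ => [true])))

/-- **The counted walk** on `⟨x, ⟨co, bin t⟩⟩`: `t` rounds of `roundO` (a counted loop over the
description as yardstick), returning the walk record. [cite: AroraBarak2009, §1.3 (bounded loops)] -/
def walkO : List Bool → List Bool := sndPow 1 ∘ loopX (roundO ∘ sndPow 1) ∘ walkInitF F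

/-- `walkInitF ∈ FP` for a uniform family. [folklore] -/
theorem walkInitF_mem_FP (hU : F.IsUniform) : walkInitF F ∈ FP := by
  have hd : F.descFn ∘ fstF ∈ FP := comp_mem_FP (QCircuitFamily.descFn_mem_FP_of_isUniform hU) fstF_mem_FP
  refine fanoutFn_mem_FP hd (fanoutFn_mem_FP (comp_mem_FP sndF_mem_FP sndF_mem_FP) (mk6_mem_FP hd ?_ ?_ ?_ (const_mem_FP _) (const_mem_FP _)))
  · exact comp_mem_FP sndF_mem_FP (comp_mem_FP sndF_mem_FP hd)
  · exact comp_mem_FP fstF_mem_FP sndF_mem_FP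
  · exact comp_mem_FP OracleCompose.concatFn_mem_FP (fanoutFn_mem_FP fstF_mem_FP
      (comp_mem_FP Kannan.zerosFn_mem_FP (comp_mem_FP fstF_mem_FP (comp_mem_FP sndF_mem_FP hd))))

/-- Growth of the loop body: `≤ 30 (|d| + 1)`. [folklore] -/
theorem length_walkBody_le (z : List Bool) :
    ((roundO ∘ sndPow 1) z).length ≤ (sndPow 1 z).length + (C roundGrowth : Polynomial ℕ).eval (fstF z).length := by
  simp only [Function.comp_apply, eval_C]
  exact length_roundO_le _

/-- **`walkO ∈ FP`** for a uniform family. [cite: AroraBarak2009, §1.3, §6.2] -/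
theorem walkO_mem_FP (hU : F.IsUniform) : walkO F ∈ FP :=
  comp_mem_FP (sndPow_mem_FP 1) (comp_mem_FP (loopX_mem_FP (comp_mem_FP roundO_mem_FP (sndPow_mem_FP 1)) (length_walkBody_le))
    (walkInitF_mem_FP F hU))

/-- The loop record on `⟨x, ⟨co, bin t⟩⟩`. [folklore] -/
theorem walkInitF_apply (x co : List Bool) (t : ℕ) :
    walkInitF F (boolPair x (boolPair co (encodeNat t))) =
      boolPair (F.descFn x) (boolPair (encodeNat t)
        (rec6 (F.descFn x) (encList (codes F x)) co (List.ofFn (w₀ F x)) (ones 0) [true])) := by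
  simp [walkInitF, descFn_eq, w₀, ofFn_padInput, fstF, sndF, ones]

/-- The model of the counted loop with a body ignoring yardstick and counter is iteration. [folklore] -/
theorem loopModel_comp_sndPow (f : List Bool → List Bool) (x : List Bool) :
    ∀ (k : ℕ) (s : List Bool), loopModel (f ∘ sndPow 1) x k s = f^[k] s
  | 0, s => rfl
  | k + 1, s => by
    rw [loopModel, loopModel_comp_sndPow f x k]
    simp only [Function.comp_apply, sndPow_succ_boolPair, Brick.sndPow_zero_boolPair]
    rw [← Function.iterate_succ_apply]

/-- **Semantics of the counted walk**: after `t ≤ μ` rounds the record holds the codes of the gates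
from `t` on, the coins `co ⇂ t`, and the state `tRunO (gates ↾ t) co (x0^m, 0, valid)`. [cite: AaronsonAmbainis2014, proof of Thm. 23 (p. 14)] -/
theorem walkO_apply (x co : List Bool) {t : ℕ} (ht : t ≤ (F.circ x.length).gates.length) :
    walkO F (boolPair x (boolPair co (encodeNat t))) =
      (let gs := (F.circ x.length).gates
       let r := tRunO (gs.take t) co (w₀ F x, 0, true)
       rec6 (F.descFn x) (encList ((gs.drop t).map QGate.encode)) (co.drop t) (List.ofFn r.1) (ones r.2.1) [r.2.2]) := by
  have htd : t ≤ (F.descFn x).length := ht.trans (length_gates_le_length_descFn F x)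
  simp only [walkO, Function.comp_apply, walkInitF_apply, loopX_apply _ _ _ htd, sndPow_succ_boolPair,
    Brick.sndPow_zero_boolPair, loopModel_comp_sndPow]
  exact iterate_roundO_prefix (F.descFn x) t _ co (w₀ F x, 0, true) ht

end Walks

end ADH

end Literature.Computability.QuantumComplexity

end
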